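import Summits.BirchSwinnertonDyer.Rank1Residual.X2.ManinEtaleSwitch
import Literature.NumberTheory.EllipticCurves.IsogenyConductorProofs
import HarnessLib

/-!
# The étale-isogeny switch along a CHAIN of `p`-isogenies, and with the conductor equality from
# Ogg–Saito (cell `bsd-eis`, seat `bsd-eis-cgshw` g9; route `EisensteinPrimes`, crux 4 `BSDpOnCellC`
# = stmt-BirchSwinnertonDyer-19034, line b1 skeleton v7, stub `stub_ctlOrSwitch`; referee g25
# extension X2 of cgshw MEMO-11; THEOREMS ONLY)

HONEST FRAMING (cell `bsd-eis`, run/shared/lean/pub/bsd-eis/): theorems only; nothing booked; X2 stays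
CONSTRUCTION-SHAPED; no label or count moves. `X2/ManinEtaleSwitch.lean` (cgshw g8, p436778) supplies
the switch disjunct of `stub_ctlOrSwitch` from ONE `p`-isogeny `φ : W₀ → W′` with non-`μ` kernel at
the Tate prime out of a curve `W₀` carrying a prime-to-`p` Manin datum (cited fact
`dokchitserStevens_maninDatum_of_pIsogeny`: DD15 Prop. 4.10 / Lemma 4.3 + Stevens 1989 (2.2)). The
cell referee's independent census (REF-VERDICT-WAVE-g25 §5, kit j253098) found that in the window
(N < 2·10⁴, 592 split X2c pairs) a torsion-free curve is reached from the optimal one by ONE such step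
in 541 classes but by a CHAIN of such steps in 578 (residual 51 → 14, all @3). This file records that
the chain costs nothing new:

* `hasPrimeToManinDatum_of_pIsogeny_chain2` / `switchDatum_of_pIsogeny_chain2(_of_not_dvd)` — two
  étale steps `W₀ → W₁ → W₂` (each of degree `p`, source multiplicative at `p`,
  `v_p(j(W_i)) = p·v_p(j(W_{i+1}))`, equal conductors): the cited fact ITERATED. WHY TWO STEPS ARE
  ALL THERE IS: at an odd `p` the `ℚ`-rational `p`-power isogeny graph of `E` is a path along which
  `v_p(q_E)` is multiplied by `p` at each step towards the `μ`-end; a curve with `E(ℚ_p)[p] = 0`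
  (`q ∉ (ℚ_p^×)^p`, as `ζ_p ∉ ℚ_p`) admits no further étale step, so it is the étale END of the path
  and is reached from ANY curve of the path — in particular from the optimal one — by étale steps
  only (DD15 Thm. A.1: the étale quotient of `E_q` is `E_{q^{1/p}}`, `z ↦ z`); and by Mazur–Kenku
  (Silverman *AEC* IX.6 Ex. 6.4; tree `kenkuDegrees`) a cyclic `ℚ`-isogeny of `p`-power degree at odd
  `p` has degree `p`, `9`, `25` or `27`, the last only at the CM invariant `j = −2¹⁵·3·5³` (never
  multiplicative), so for an X2 pair the path has at most TWO edges.
* `switchDatum_of_pIsogeny_of_tate` / `switchDatum_of_pIsogeny_chain2_of_tate` — the same with the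
  conductor equalities DISCHARGED class-wide by the tree's
  `conductorNorm_eq_of_isIsogenous_of_tate` (Ogg–Saito in Galois form, the named fact schema
  `artinConductorExponent_tate_eq_conductorExponent_of_isElliptic`, Silverman *ATAEC* IV.10–11).

So the switch disjunct of `stub_ctlOrSwitch` at a class = [cited DD15/Stevens fact] + [Ogg–Saito
schema] + an explicit étale `p`-isogeny path of length ≤ 2 from a curve with a prime-to-`p` Manin
datum (the optimal curve: Mazur) + the local datum at its end (`p ∤ v_p(Δ_min)` or the raw
`E(ℚ_p)[p] = 0`). What is NOT here: no claim about the 14 window classes @3 (e.g. `402d1`, `906c1`,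
`1158c1` per MEMO-11 N3 ∩ referee §5) whose étale end still has `ℚ_3`-rational `3`-torsion — there
only the control theorem WITH local torsion (MEMO-7 (I1)–(I6), unprinted) can serve; nothing booked.

References: [DokchitserDokchitser2015LocalInvariants] Prop. 4.10, Lemma 4.3, Thm. A.1;
[Stevens1989] §2 Lemma (2.2); [SilvermanAEC2009] IX.6 Example 6.4; [SilvermanATAEC1994] IV.10,
Exercise 4.40; [Mazur1978] Thm. 1, Cor. 4.1; [Kenku1982] Thm. 1; cgshw MEMO-11, REF-VERDICT-WAVE-g25 §5.
-/

set_option autoImplicit false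

noncomputable section

open scoped Classical MatrixGroups ModularForm

open CongruenceSubgroup WeierstrassCurve NumberField IsDedekindDomain Field
  Literature.NumberTheory.EllipticCurves Literature.NumberTheory.EllipticCurves.GreenbergSelmer
  Literature.NumberTheory.EllipticCurves.ModularForms Literature.NumberTheory.QuadraticFields
  Literature.NumberTheory.EllipticCurves.Rank1Residual
  Literature.NumberTheory.EllipticCurves.Rank1Residual.Typed
  Literature.NumberTheory.GaloisRepresentations Literature.NumberTheory.GaloisCohomology
  Literature.NumberTheory.Automorphic
  Summit.BirchSwinnertonDyer.Rank1Residual.X11b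

namespace Summit.BirchSwinnertonDyer.Rank1Residual.X2

/-! ### Two étale steps -/

section Chain

variable {W₀ W₁ W₂ : WeierstrassCurve ℚ} [W₀.IsElliptic] [W₁.IsElliptic] [W₂.IsElliptic]
  [W₀.IsGloballyMinimal] [W₁.IsGloballyMinimal] [W₂.IsGloballyMinimal] {p : ℕ} [Fact p.Prime]

/-- **`HasPrimeToManinDatum` passes along a CHAIN of two `p`-isogenies with non-`μ` kernels at the
Tate prime** — `hasPrimeToManinDatum_of_pIsogeny` (p436778) applied twice: `W₀ → W₁ → W₂`, each step
of degree `p` with source multiplicative at `p`, `v_p(j)` dropping by the factor `p`, and equal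
conductors. CONDITIONAL on the cited fact `dokchitserStevens_maninDatum_of_pIsogeny`; nothing booked.
[cite: DokchitserDokchitser2015LocalInvariants, Prop. 4.10 (p. 4348) and Lemma 4.3 (p. 4345)]
[cite: Stevens1989, §2 Lemma (2.2)] -/
theorem hasPrimeToManinDatum_of_pIsogeny_chain2 (hDS : dokchitserStevens_maninDatum_of_pIsogeny)
    (hMan : HasPrimeToManinDatum W₀ p) (φ₁ : Isogeny W₀ W₁) (φ₂ : Isogeny W₁ W₂)
    (hdeg₁ : φ₁.degree = p) (hdeg₂ : φ₂.degree = p)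
    (hmult₀ : W₀.HasMultiplicativeReductionAtPrime p) (hmult₁ : W₁.HasMultiplicativeReductionAtPrime p)
    (hj₁ : padicValRat p W₀.j = p * padicValRat p W₁.j)
    (hj₂ : padicValRat p W₁.j = p * padicValRat p W₂.j)
    (hN₁ : W₁.conductorNorm ℤ = W₀.conductorNorm ℤ) (hN₂ : W₂.conductorNorm ℤ = W₁.conductorNorm ℤ) :
    HasPrimeToManinDatum W₂ p :=
  hasPrimeToManinDatum_of_pIsogeny hDS
    (hasPrimeToManinDatum_of_pIsogeny hDS hMan φ₁ hdeg₁ hmult₀ hj₁ hN₁) φ₂ hdeg₂ hmult₁ hj₂ hN₂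

/-- **The switch disjunct of `stub_ctlOrSwitch` from a two-step étale chain.** For `W` in the
isogeny class of `W₀` (`HasPrimeToManinDatum W₀ p`, e.g. the optimal curve), a chain `W₀ → W₁ → W₂`
of `p`-isogenies with non-`μ` kernels at the Tate prime and equal conductors, and `W₂(ℚ_p)[p] = 0`:
the datum `∃ W″ ∼ W` (globally minimal) with `HasPrimeToManinDatum W″ p` and no `ℚ_p`-rational
`p`-torsion (`W″ := W₂`). At an odd multiplicative `p` the rational `p`-power isogeny path of a
non-CM curve has at most two edges (Mazur–Kenku), so with `switchDatum_of_pIsogeny` this is the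
general case. CONDITIONAL on the cited fact; nothing booked.
[cite: DokchitserDokchitser2015LocalInvariants, Prop. 4.10 (p. 4348) and Thm. A.1 (p. 4354)]
[cite: Stevens1989, §2 Lemma (2.2)] [cite: SilvermanAEC2009, IX.6 Example 6.4] -/
theorem switchDatum_of_pIsogeny_chain2 (hDS : dokchitserStevens_maninDatum_of_pIsogeny)
    {W : WeierstrassCurve ℚ} [W.IsElliptic] [W.IsGloballyMinimal] (hiso : IsIsogenous W W₀)
    (hMan : HasPrimeToManinDatum W₀ p) (φ₁ : Isogeny W₀ W₁) (φ₂ : Isogeny W₁ W₂)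
    (hdeg₁ : φ₁.degree = p) (hdeg₂ : φ₂.degree = p)
    (hmult₀ : W₀.HasMultiplicativeReductionAtPrime p) (hmult₁ : W₁.HasMultiplicativeReductionAtPrime p)
    (hj₁ : padicValRat p W₀.j = p * padicValRat p W₁.j)
    (hj₂ : padicValRat p W₁.j = p * padicValRat p W₂.j)
    (hN₁ : W₁.conductorNorm ℤ = W₀.conductorNorm ℤ) (hN₂ : W₂.conductorNorm ℤ = W₁.conductorNorm ℤ)
    (h0 : ∀ Q₀ : (W₂.baseChange ℚ_[p]).toAffine.Point, p • Q₀ = 0 → Q₀ = 0) :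
    ∃ (W'' : WeierstrassCurve ℚ) (_ : W''.IsElliptic) (_ : W''.IsGloballyMinimal),
      IsIsogenous W W'' ∧ HasPrimeToManinDatum W'' p ∧
        ∀ Q₀ : (W''.baseChange ℚ_[p]).toAffine.Point, p • Q₀ = 0 → Q₀ = 0 :=
  ⟨W₂, inferInstance, inferInstance, (hiso.trans' ⟨φ₁⟩).trans' ⟨φ₂⟩,
    hasPrimeToManinDatum_of_pIsogeny_chain2 hDS hMan φ₁ φ₂ hdeg₁ hdeg₂ hmult₀ hmult₁ hj₁ hj₂ hN₁ hN₂,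
    h0⟩

/-- **The same with the local input at the end of the chain in its kernel-checkable form
`p ∤ v_p(Δ_min(W₂))`** (`p ≥ 3`, `W₂` multiplicative at `p`:
`X11b.LocalTorsion.localTorsion_eq_zero_of_mult`). CONDITIONAL on the cited fact; nothing booked.
[cite: SilvermanAEC2009, Thm VII.6.1 and Exercise 3.5]
[cite: DokchitserDokchitser2015LocalInvariants, Prop. 4.10 (p. 4348)] -/
theorem switchDatum_of_pIsogeny_chain2_of_not_dvd (hDS : dokchitserStevens_maninDatum_of_pIsogeny)
    {W : WeierstrassCurve ℚ} [W.IsElliptic] [W.IsGloballyMinimal] (hiso : IsIsogenous W W₀)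
    (hMan : HasPrimeToManinDatum W₀ p) (φ₁ : Isogeny W₀ W₁) (φ₂ : Isogeny W₁ W₂)
    (hdeg₁ : φ₁.degree = p) (hdeg₂ : φ₂.degree = p)
    (hmult₀ : W₀.HasMultiplicativeReductionAtPrime p) (hmult₁ : W₁.HasMultiplicativeReductionAtPrime p)
    (hj₁ : padicValRat p W₀.j = p * padicValRat p W₁.j)
    (hj₂ : padicValRat p W₁.j = p * padicValRat p W₂.j)
    (hN₁ : W₁.conductorNorm ℤ = W₀.conductorNorm ℤ) (hN₂ : W₂.conductorNorm ℤ = W₁.conductorNorm ℤ)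
    (hp3 : 3 ≤ p) (hmult₂ : Mult W₂ p) (hv : ¬ p ∣ padicValInt p W₂.minimalDiscriminantInt) :
    ∃ (W'' : WeierstrassCurve ℚ) (_ : W''.IsElliptic) (_ : W''.IsGloballyMinimal),
      IsIsogenous W W'' ∧ HasPrimeToManinDatum W'' p ∧
        ∀ Q₀ : (W''.baseChange ℚ_[p]).toAffine.Point, p • Q₀ = 0 → Q₀ = 0 :=
  switchDatum_of_pIsogeny_chain2 hDS hiso hMan φ₁ φ₂ hdeg₁ hdeg₂ hmult₀ hmult₁ hj₁ hj₂ hN₁ hN₂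
    (X11b.LocalTorsion.localTorsion_eq_zero_of_mult W₂ p hp3 hmult₂ (Or.inr hv))

end Chain

/-! ### The conductor equalities from Ogg–Saito -/

section Tate

variable {W₀ W₁ W₂ : WeierstrassCurve ℚ} [W₀.IsElliptic] [W₁.IsElliptic] [W₂.IsElliptic]
  [W₀.IsGloballyMinimal] [W₁.IsGloballyMinimal] [W₂.IsGloballyMinimal] {p : ℕ} [Fact p.Prime]

/-- **One étale step, conductor equality from Ogg–Saito**: `switchDatum_of_pIsogeny` (p436778) with
`N(W₁) = N(W₀)` DISCHARGED by the tree's `conductorNorm_eq_of_isIsogenous_of_tate` granted the named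
schema `hOS` (Ogg–Saito in Galois form: `a_v(V_ℓ E) = f_v(E)` for `v ∤ ℓ`, Silverman *ATAEC*
IV.10.2/IV.11.1). CONDITIONAL on the two cited facts; nothing booked.
[cite: SilvermanATAEC1994, Exercise 4.40 (PDF p. 380) with §IV.10 and Thm. IV.11.1]
[cite: DokchitserDokchitser2015LocalInvariants, Prop. 4.10 (p. 4348)] [cite: Stevens1989, §2 Lemma (2.2)] -/
theorem switchDatum_of_pIsogeny_of_tate (hDS : dokchitserStevens_maninDatum_of_pIsogeny)
    (hOS : ∀ (W : WeierstrassCurve ℚ) (ℓ : ℕ) [Fact ℓ.Prime],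
      W.artinConductorExponent_tate_eq_conductorExponent_of_isElliptic ℓ)
    {W : WeierstrassCurve ℚ} [W.IsElliptic] [W.IsGloballyMinimal] (hiso : IsIsogenous W W₀)
    (hMan : HasPrimeToManinDatum W₀ p) (φ : Isogeny W₀ W₁) (hdeg : φ.degree = p)
    (hmult : W₀.HasMultiplicativeReductionAtPrime p)
    (hj : padicValRat p W₀.j = p * padicValRat p W₁.j)
    (h0 : ∀ Q₀ : (W₁.baseChange ℚ_[p]).toAffine.Point, p • Q₀ = 0 → Q₀ = 0) :
    ∃ (W'' : WeierstrassCurve ℚ) (_ : W''.IsElliptic) (_ : W''.IsGloballyMinimal),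
      IsIsogenous W W'' ∧ HasPrimeToManinDatum W'' p ∧
        ∀ Q₀ : (W''.baseChange ℚ_[p]).toAffine.Point, p • Q₀ = 0 → Q₀ = 0 :=
  switchDatum_of_pIsogeny hDS hiso hMan φ hdeg hmult hj
    (conductorNorm_eq_of_isIsogenous_of_tate hOS W₀ W₁ ⟨φ⟩).symm h0

/-- **Two étale steps, conductor equalities from Ogg–Saito**: `switchDatum_of_pIsogeny_chain2` with
both conductor equalities DISCHARGED by `conductorNorm_eq_of_isIsogenous_of_tate` granted `hOS`.
CONDITIONAL on the two cited facts; nothing booked.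
[cite: SilvermanATAEC1994, Exercise 4.40 (PDF p. 380) with §IV.10 and Thm. IV.11.1]
[cite: DokchitserDokchitser2015LocalInvariants, Prop. 4.10 (p. 4348) and Thm. A.1 (p. 4354)]
[cite: Stevens1989, §2 Lemma (2.2)] -/
theorem switchDatum_of_pIsogeny_chain2_of_tate (hDS : dokchitserStevens_maninDatum_of_pIsogeny)
    (hOS : ∀ (W : WeierstrassCurve ℚ) (ℓ : ℕ) [Fact ℓ.Prime],
      W.artinConductorExponent_tate_eq_conductorExponent_of_isElliptic ℓ)
    {W : WeierstrassCurve ℚ} [W.IsElliptic] [W.IsGloballyMinimal] (hiso : IsIsogenous W W₀)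
    (hMan : HasPrimeToManinDatum W₀ p) (φ₁ : Isogeny W₀ W₁) (φ₂ : Isogeny W₁ W₂)
    (hdeg₁ : φ₁.degree = p) (hdeg₂ : φ₂.degree = p)
    (hmult₀ : W₀.HasMultiplicativeReductionAtPrime p) (hmult₁ : W₁.HasMultiplicativeReductionAtPrime p)
    (hj₁ : padicValRat p W₀.j = p * padicValRat p W₁.j)
    (hj₂ : padicValRat p W₁.j = p * padicValRat p W₂.j)
    (h0 : ∀ Q₀ : (W₂.baseChange ℚ_[p]).toAffine.Point, p • Q₀ = 0 → Q₀ = 0) :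
    ∃ (W'' : WeierstrassCurve ℚ) (_ : W''.IsElliptic) (_ : W''.IsGloballyMinimal),
      IsIsogenous W W'' ∧ HasPrimeToManinDatum W'' p ∧
        ∀ Q₀ : (W''.baseChange ℚ_[p]).toAffine.Point, p • Q₀ = 0 → Q₀ = 0 :=
  switchDatum_of_pIsogeny_chain2 hDS hiso hMan φ₁ φ₂ hdeg₁ hdeg₂ hmult₀ hmult₁ hj₁ hj₂
    (conductorNorm_eq_of_isIsogenous_of_tate hOS W₀ W₁ ⟨φ₁⟩).symm
    (conductorNorm_eq_of_isIsogenous_of_tate hOS W₁ W₂ ⟨φ₂⟩).symm h0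

end Tate

end Summit.BirchSwinnertonDyer.Rank1Residual.X2

end
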